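import Literature.MathematicalPhysics.QuantumLattice.GrassmannGramFormAlgebra
import HarnessLib

/-!
# Zero extension of a charged Gram form to inert (spectator) labels: `fromBlocks C 0 0 0` on `Γ ⊕ ρ` keeps the Gram constant, the row sums and the sup

Topic `MathematicalPhysics/QuantumLattice`; continuation of `GrassmannGramFormAlgebra` (`isGramBoundedR_of_gram`, `isGramBoundedR_blockCopies_of_gram`).
When a Gaussian step is re-expressed with spectator generators (`GrassmannSpectatorReadout`: the covariance of the enlarged algebra `Γ ⊕ ρ` is
`fromBlocks C 0 0 0`, the spectators do not fluctuate), the step's covariance data are those of `C`: the charged Gram form `contr C X̄ Y = ⟨f X̄, g Y⟩` extends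
by `0` to the spectators (BGM 2006 (2.80): the Gram representation is label-wise), every row/column sum of `‖·‖ × weight` over `Γ ⊕ ρ` is the corresponding
sum over `Γ` (or `0`), and the sup of the entries is unchanged.

* `fromBlocks_zero_apply_inl_inl` / `…_of_isRight_left` / `…_of_isRight_right` — the entries; `contr_fromBlocks_zero_inl_inl`, `contr_fromBlocks_zero_eq_zero_left/right`;
* **`isGramBoundedR_fromBlocks_zero_of_gram`** — a charged Gram form of `C` with constant `κ` gives `IsGramBoundedR (fromBlocks C 0 0 0) κ`;
* **`rowSum_fromBlocks_zero_le`**, **`colSum_fromBlocks_zero_le`** — weighted row/column sums of `‖fromBlocks C 0 0 0‖` from those of `‖C‖` (weight pulled back along `inl`);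
* `norm_fromBlocks_zero_le` — the sup bound.

Everything is proved; no definition, no named fact.

## Sources
G. Benfatto, A. Giuliani, V. Mastropietro, Ann. Henri Poincaré 7 (2006) 809–898, (2.67), (2.80) [`BenfattoGiulianiMastropietro2006`];
W. de Siqueira Pedra, M. Salmhofer, Comm. Math. Phys. 282 (2008) 797–818, Thm 1.3 [`PedraSalmhofer2008`].
-/

noncomputable section

namespace Literature.MathematicalPhysics.QuantumLattice

open GrassmannAlgebra Finset
open scoped InnerProductSpace

universe u

variable {𝕜 : Type*} [RCLike 𝕜]
variable {E₁ : Type*} [NormedAddCommGroup E₁] [InnerProductSpace 𝕜 E₁]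
variable {Γ : Type u} [Fintype Γ] {ρ : Type} [Fintype ρ]

/-! ### The entries and the two-point function of the zero extension -/

omit [Fintype Γ] [Fintype ρ] in
/-- The `inl/inl` block is `C`. [cite: BenfattoGiulianiMastropietro2006, (2.67)] -/
theorem fromBlocks_zero_apply_inl_inl (C : Matrix Γ Γ 𝕜) (X Y : Γ) :
    (Matrix.fromBlocks C (0 : Matrix Γ ρ 𝕜) (0 : Matrix ρ Γ 𝕜) (0 : Matrix ρ ρ 𝕜)) (Sum.inl X) (Sum.inl Y) = C X Y := rfl

omit [Fintype Γ] [Fintype ρ] in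
/-- A spectator row vanishes. [cite: BenfattoGiulianiMastropietro2006, (2.67)] -/
theorem fromBlocks_zero_apply_inr_left (C : Matrix Γ Γ 𝕜) (a : ρ) (Y' : Γ ⊕ ρ) :
    (Matrix.fromBlocks C (0 : Matrix Γ ρ 𝕜) (0 : Matrix ρ Γ 𝕜) (0 : Matrix ρ ρ 𝕜)) (Sum.inr a) Y' = 0 := by
  cases Y' <;> rfl

omit [Fintype Γ] [Fintype ρ] in
/-- A spectator column vanishes. [cite: BenfattoGiulianiMastropietro2006, (2.67)] -/
theorem fromBlocks_zero_apply_inr_right (C : Matrix Γ Γ 𝕜) (X' : Γ ⊕ ρ) (a : ρ) :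
    (Matrix.fromBlocks C (0 : Matrix Γ ρ 𝕜) (0 : Matrix ρ Γ 𝕜) (0 : Matrix ρ ρ 𝕜)) X' (Sum.inr a) = 0 := by
  cases X' <;> rfl

omit [Fintype Γ] [Fintype ρ] in
/-- The two-point function of the zero extension on the `inl/inl` block is that of `C`. [cite: BenfattoGiulianiMastropietro2006, (2.67)] -/
theorem contr_fromBlocks_zero_inl_inl (C : Matrix Γ Γ 𝕜) (X Y : Γ) :
    contr 𝕜 (Matrix.fromBlocks C (0 : Matrix Γ ρ 𝕜) (0 : Matrix ρ Γ 𝕜) (0 : Matrix ρ ρ 𝕜)) (Sum.inl X) (Sum.inl Y) = contr 𝕜 C X Y := by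
  rw [contr_apply, contr_apply, fromBlocks_zero_apply_inl_inl, fromBlocks_zero_apply_inl_inl]

omit [Fintype Γ] [Fintype ρ] in
/-- The two-point function vanishes on a spectator row. [cite: BenfattoGiulianiMastropietro2006, (2.67)] -/
theorem contr_fromBlocks_zero_eq_zero_left (C : Matrix Γ Γ 𝕜) (a : ρ) (Y' : Γ ⊕ ρ) :
    contr 𝕜 (Matrix.fromBlocks C (0 : Matrix Γ ρ 𝕜) (0 : Matrix ρ Γ 𝕜) (0 : Matrix ρ ρ 𝕜)) (Sum.inr a) Y' = 0 := by
  rw [contr_apply, fromBlocks_zero_apply_inr_left, fromBlocks_zero_apply_inr_right, sub_zero, mul_zero]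

omit [Fintype Γ] [Fintype ρ] in
/-- The two-point function vanishes on a spectator column. [cite: BenfattoGiulianiMastropietro2006, (2.67)] -/
theorem contr_fromBlocks_zero_eq_zero_right (C : Matrix Γ Γ 𝕜) (X' : Γ ⊕ ρ) (a : ρ) :
    contr 𝕜 (Matrix.fromBlocks C (0 : Matrix Γ ρ 𝕜) (0 : Matrix ρ Γ 𝕜) (0 : Matrix ρ ρ 𝕜)) X' (Sum.inr a) = 0 := by
  rw [contr_apply, fromBlocks_zero_apply_inr_left, fromBlocks_zero_apply_inr_right, sub_zero, mul_zero]

/-! ### The Gram constant -/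

/-- **THE ZERO EXTENSION OF A CHARGED GRAM FORM IS REPLICA-GRAM-BOUNDED WITH THE SAME CONSTANT**: if `C` vanishes on equal charges (`q`) and
`contr C X̄ Y = ⟨f X̄, g Y⟩` with `‖f‖, ‖g‖ ≤ κ`, then `fromBlocks C 0 0 0` on `Γ ⊕ ρ` (spectators with any charge assignment `qρ`) is `IsGramBoundedR` with constant `κ`
— the vectors extend by `0`. [cite: BenfattoGiulianiMastropietro2006, (2.80)] -/
theorem isGramBoundedR_fromBlocks_zero_of_gram (q : Γ → Bool) (qρ : ρ → Bool) (C : Matrix Γ Γ 𝕜) (hC : ∀ X Y, q X = q Y → C X Y = 0)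
    (f g : Γ → E₁) {κ : ℝ} (hκ : 0 ≤ κ) (hf : ∀ X, q X = true → ‖f X‖ ≤ κ) (hg : ∀ Y, q Y = false → ‖g Y‖ ≤ κ)
    (hG : ∀ X Y, q X = true → q Y = false → contr 𝕜 C X Y = ⟪f X, g Y⟫_𝕜) :
    IsGramBoundedR (Matrix.fromBlocks C (0 : Matrix Γ ρ 𝕜) (0 : Matrix ρ Γ 𝕜) (0 : Matrix ρ ρ 𝕜)) κ := by
  refine isGramBoundedR_of_gram (Sum.elim q qρ) _ (fun X' Y' hXY => ?_) (Sum.elim f (fun _ => 0)) (Sum.elim g (fun _ => 0)) hκ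
    (fun X' hX => ?_) (fun Y' hY => ?_) (fun X' Y' hX hY => ?_)
  · rcases X' with X | a
    · rcases Y' with Y | b
      · exact hC X Y hXY
      · exact fromBlocks_zero_apply_inr_right C _ b
    · exact fromBlocks_zero_apply_inr_left C a Y'
  · rcases X' with X | a
    · exact hf X hX
    · simp only [Sum.elim_inr, norm_zero]; exact hκ
  · rcases Y' with Y | b
    · exact hg Y hY
    · simp only [Sum.elim_inr, norm_zero]; exact hκ
  · rcases X' with X | a
    · rcases Y' with Y | b
      · rw [contr_fromBlocks_zero_inl_inl]; exact hG X Y hX hY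
      · rw [contr_fromBlocks_zero_eq_zero_right]; simp
    · rw [contr_fromBlocks_zero_eq_zero_left]; simp

/-! ### Row and column sums, sup -/

/-- **Weighted row sums of the zero extension**: if `Σ_Y ‖C X Y‖·w (inl X) (inl Y) ≤ α` for every `X` and `0 ≤ α`, then
`Σ_{Y'} ‖(fromBlocks C 0 0 0) X' Y'‖·w X' Y' ≤ α` for every `X' : Γ ⊕ ρ`. [cite: BenfattoGiulianiMastropietro2006, (2.80)] -/
theorem rowSum_fromBlocks_zero_le (C : Matrix Γ Γ 𝕜) (w : Γ ⊕ ρ → Γ ⊕ ρ → ℝ) {α : ℝ} (hα : 0 ≤ α)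
    (hrow : ∀ X, ∑ Y, ‖C X Y‖ * w (Sum.inl X) (Sum.inl Y) ≤ α) (X' : Γ ⊕ ρ) :
    ∑ Y', ‖(Matrix.fromBlocks C (0 : Matrix Γ ρ 𝕜) (0 : Matrix ρ Γ 𝕜) (0 : Matrix ρ ρ 𝕜)) X' Y'‖ * w X' Y' ≤ α := by
  rw [Fintype.sum_sum_type]
  rcases X' with X | a
  · simp only [fromBlocks_zero_apply_inl_inl, fromBlocks_zero_apply_inr_right, norm_zero, zero_mul, sum_const_zero, add_zero]
    exact hrow X
  · simp only [fromBlocks_zero_apply_inr_left, norm_zero, zero_mul, sum_const_zero, add_zero]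
    exact hα

/-- **Weighted column sums of the zero extension.** [cite: BenfattoGiulianiMastropietro2006, (2.80)] -/
theorem colSum_fromBlocks_zero_le (C : Matrix Γ Γ 𝕜) (w : Γ ⊕ ρ → Γ ⊕ ρ → ℝ) {α : ℝ} (hα : 0 ≤ α)
    (hcol : ∀ Y, ∑ X, ‖C X Y‖ * w (Sum.inl X) (Sum.inl Y) ≤ α) (Y' : Γ ⊕ ρ) :
    ∑ X', ‖(Matrix.fromBlocks C (0 : Matrix Γ ρ 𝕜) (0 : Matrix ρ Γ 𝕜) (0 : Matrix ρ ρ 𝕜)) X' Y'‖ * w X' Y' ≤ α := by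
  rw [Fintype.sum_sum_type]
  rcases Y' with Y | b
  · simp only [fromBlocks_zero_apply_inl_inl, fromBlocks_zero_apply_inr_left, norm_zero, zero_mul, sum_const_zero, add_zero]
    exact hcol Y
  · simp only [fromBlocks_zero_apply_inr_right, norm_zero, zero_mul, sum_const_zero, add_zero]
    exact hα

omit [Fintype Γ] [Fintype ρ] in
/-- **The sup of the zero extension**: `‖(fromBlocks C 0 0 0) X' Y'‖ ≤ s` whenever `‖C X Y‖ ≤ s` for all `X, Y` and `0 ≤ s`. [cite: BenfattoGiulianiMastropietro2006, (2.80)] -/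
theorem norm_fromBlocks_zero_le (C : Matrix Γ Γ 𝕜) {s : ℝ} (hs0 : 0 ≤ s) (hs : ∀ X Y, ‖C X Y‖ ≤ s) (X' Y' : Γ ⊕ ρ) :
    ‖(Matrix.fromBlocks C (0 : Matrix Γ ρ 𝕜) (0 : Matrix ρ Γ 𝕜) (0 : Matrix ρ ρ 𝕜)) X' Y'‖ ≤ s := by
  rcases X' with X | a
  · rcases Y' with Y | b
    · exact hs X Y
    · rw [fromBlocks_zero_apply_inr_right, norm_zero]; exact hs0
  · rw [fromBlocks_zero_apply_inr_left, norm_zero]; exact hs0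

end Literature.MathematicalPhysics.QuantumLattice

end
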